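import Summits.ResolutionOfSingularities.ResolutionOfSingularities.Theorems.PurelyInseparableDim4CoordinateTrap
import Literature.AlgebraicGeometry.Resolution.CentreBlowupOrdAlongBasics
import Literature.AlgebraicGeometry.Resolution.CentreBlowupMohStability
import HarnessLib

/-!
# A UNIFORM two-state trap (1/2: the specimen and its step): every coordinate-centre termination frame of
# the cell is blind at EVERY exponent `q ≥ 2` over EVERY field (cell `res-dim4-pi`, W3-2 «T-002 for all p»)

[OURS · counted 0] **Negative result about OUR candidate frames v1–v3** (`PIDim4.Terminates1h`,
`Terminates1h2`, `TerminatesM1`, `TerminatesSomeRule`, `SecondaryInvariantExists(Sym)`) — nothing about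
resolution of singularities.  The census had these refuted at `p = q = 2` only (K-S1-1: crit-1's 2-cycle
`Mode1hTwoCycle`; K-S2-1: idea-3's TRAP-1 `CoordinateTrap`; PR-7: idea-2's m1 3-cycle `M1Cycle`; desk row
T-002 = the (3,1)-embedded reduction `F₃ = x₃x₄ + x₂x₃ + x₂x₃x₄`).  Here ONE specimen does it for ALL
exponents `q ≥ 2` over ANY field `K` (so for every prime `p` with `q = pᵉ`, `e ≥ 1`, and in characteristic 0):

  `F_ε = x₃^{q−1}·(x₄ + ε·x₂ + x₂x₄)`  (`ε = ±1`),   `s_ε = (F_ε, r = 0, exc = {x₂})`,   `T = {s₁, s₋₁}`.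

* the Hironaka-permissible coordinate centres of `z^q + F_ε` are EXACTLY `V(z,x₂,x₃,x₄)` and the point
  (`isPermissibleCentre_iff_subset`); both satisfy Hauser–Perlega's condition (2) (`perm2_of_subset`);
* for either centre, the `x₂`-chart at the point `x₄ ↦ x₄ − ε` of the new exceptional divisor is
  equimultiple and its cleaned transform is `s_{−ε}` LITERALLY (`step_st`): chart `x₃^{q−1}(x₄ + ε + x₂x₄)`,
  translate, the constants cancel;
* hence `T` is an `IsTrap` (`isTrap`), `s₁ → s₋₁ → s₁ → …` is simultaneously a MODE-1h, a 1h2, an m1 and an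
  HP-permissible branch, and `TerminatesSomeRule p q`, `Terminates1h p q`, `Terminates1h2 p q`,
  `TerminatesM1 p q`, `SecondaryInvariantExists p q` are FALSE for every prime `p` and every `q ≥ 2`
  (part 2/2 `PurelyInseparableDim4UniformTrapFrames`: `isTrap`, `not_terminatesSomeRule_of_prime`, …).

Geometry (why this is about the frame, not about resolution): `F_ε = x₃^{q−1}·w` with
`w = x₄ + εx₂ + x₂x₄` a REGULAR non-coordinate parameter; the `q`-fold locus of `z^q + F_ε` is the smooth
surface `V(z, x₃, w)`, which no coordinate subspace of the presented chart equals, and the configuration is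
self-similar under the two admissible coordinate blow-ups — already in three variables (`x₁` is a dummy),
i.e. inside Cossart–Piltant's resolved dimension.  For `q = 2` over `𝔽₂`, `s₁ = s₋₁` is the desk's T-002.
Frame v4 (`TerminatesInScope`, `NoIsolatedTrap`, `SpineTerminatesSomeRule`) is untouched by design
(the trap is out of coordinate scope, non-isolated, and off the spine).
Variables `x₁..x₄` are `Fin 4 = 0..3`.  OURS; nothing here proves resolution in dim ≥ 4 / char p; counted 0.
bears_on: LADDER-RESOLUTION:D157-DOOR2 (res-dim4-pi · W3-2). Supports stmt-ResolutionOfSingularities-16155 (helper).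
-/

set_option linter.dupNamespace false -- mandated namespace of this single-conjunct summit

namespace Summit.ResolutionOfSingularities.ResolutionOfSingularities.Theorems.PIDim4

noncomputable section

namespace UniformTrap

open MvPolynomial Finset
open Literature.AlgebraicGeometry.Resolution
open Literature.AlgebraicGeometry.Resolution.Hauser2010
open Literature.AlgebraicGeometry.Resolution.CentreBlowup

variable {K : Type} [Field K]

/-! ## the data -/

/-- exponent of `x₃^{q−1}x₄`. [folklore] -/
def e1 (q : ℕ) : Fin 4 →₀ ℕ := Finsupp.equivFunOnFinite.symm ![0, 0, q - 1, 1]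
/-- exponent of `x₂x₃^{q−1}`. [folklore] -/
def e2 (q : ℕ) : Fin 4 →₀ ℕ := Finsupp.equivFunOnFinite.symm ![0, 1, q - 1, 0]
/-- exponent of `x₂x₃^{q−1}x₄`. [folklore] -/
def e3 (q : ℕ) : Fin 4 →₀ ℕ := Finsupp.equivFunOnFinite.symm ![0, 1, q - 1, 1]
/-- exponent of `x₃^{q−1}` (appears in the chart transform). [folklore] -/
def e0 (q : ℕ) : Fin 4 →₀ ℕ := Finsupp.equivFunOnFinite.symm ![0, 0, q - 1, 0]

/-- Pointwise values of `e1`. -/ @[simp] theorem e1_apply (q : ℕ) (i : Fin 4) : e1 q i = ![0, 0, q - 1, 1] i := rfl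
/-- Pointwise values of `e2`. -/ @[simp] theorem e2_apply (q : ℕ) (i : Fin 4) : e2 q i = ![0, 1, q - 1, 0] i := rfl
/-- Pointwise values of `e3`. -/ @[simp] theorem e3_apply (q : ℕ) (i : Fin 4) : e3 q i = ![0, 1, q - 1, 1] i := rfl
/-- Pointwise values of `e0`. -/ @[simp] theorem e0_apply (q : ℕ) (i : Fin 4) : e0 q i = ![0, 0, q - 1, 0] i := rfl

/-- Exponents differing at one index are different. -/
private theorem ne_of_apply_ne' {d e : Fin 4 →₀ ℕ} (i : Fin 4) (h : d i ≠ e i) : d ≠ e :=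
  fun hde => h (by rw [hde])

/-- `e1 ≠ e2`. -/ theorem e1_ne_e2 (q : ℕ) : e1 q ≠ e2 q := ne_of_apply_ne' 1 (by simp)
/-- `e1 ≠ e3`. -/ theorem e1_ne_e3 (q : ℕ) : e1 q ≠ e3 q := ne_of_apply_ne' 1 (by simp)
/-- `e2 ≠ e3`. -/ theorem e2_ne_e3 (q : ℕ) : e2 q ≠ e3 q := ne_of_apply_ne' 3 (by simp)
/-- `e1 ≠ e0`. -/ theorem e1_ne_e0 (q : ℕ) : e1 q ≠ e0 q := ne_of_apply_ne' 3 (by simp)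
/-- `e0 ≠ e3`. -/ theorem e0_ne_e3 (q : ℕ) : e0 q ≠ e3 q := ne_of_apply_ne' 1 (by simp)

/-- `F_ε = x₃^{q−1}x₄ + ε·x₂x₃^{q−1} + x₂x₃^{q−1}x₄ = x₃^{q−1}(x₄ + εx₂ + x₂x₄)`. [folklore] -/
def F (q : ℕ) (ε : K) : MvPolynomial (Fin 4) K := monomial (e1 q) 1 + monomial (e2 q) ε + monomial (e3 q) 1

/-- `G_ε = x₃^{q−1}(x₄ + ε + x₂x₄)`: the `x₂`-chart transform of `F_ε`. [folklore] -/
def G (q : ℕ) (ε : K) : MvPolynomial (Fin 4) K := monomial (e1 q) 1 + monomial (e0 q) ε + monomial (e3 q) 1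

/-- the presented state `s_ε = (F_ε, r = 0, exc = {x₂})`. [folklore] -/
def st (q : ℕ) (ε : K) : State K := ⟨F q ε, 0, {1}⟩

/-- the chart point `x₄ ↦ x₄ − ε` of the `x₂`-chart (all other coordinates `0`). [folklore] -/
def bv (ε : K) : Fin 4 → K := ![0, 0, 0, -ε]

/-- the coordinate triple `{x₂, x₃, x₄}` (the line `V(z,x₂,x₃,x₄)`, i.e. the `x₁`-axis). [folklore] -/
def T123 : Finset (Fin 4) := {1, 2, 3}

/-- `bv ε 1 = 0` (the point lies on the new exceptional divisor of the `x₂`-chart). -/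
@[simp] theorem bv_one (ε : K) : bv ε 1 = 0 := rfl
/-- `bv ε 0 = 0`. -/ @[simp] theorem bv_zero (ε : K) : bv ε 0 = 0 := rfl
/-- `bv ε 2 = 0`. -/ @[simp] theorem bv_two (ε : K) : bv ε 2 = 0 := rfl
/-- `bv ε 3 = -ε`. -/ @[simp] theorem bv_three (ε : K) : bv ε 3 = -ε := rfl

/-! ## coefficients, support, orders -/

/-- Coefficients of `F_ε`. -/
theorem coeff_F (q : ℕ) (ε : K) (d : Fin 4 →₀ ℕ) : coeff d (F q ε) =
    (if e1 q = d then 1 else 0) + (if e2 q = d then ε else 0) + (if e3 q = d then 1 else 0) := by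
  simp only [F, coeff_add, coeff_monomial]

/-- The coefficient of `x₃^{q−1}x₄` in `F_ε` is `1`. -/
theorem coeff_e1_F (q : ℕ) (ε : K) : coeff (e1 q) (F q ε) = 1 := by
  rw [coeff_F, if_pos rfl, if_neg (e1_ne_e2 q).symm, if_neg (e1_ne_e3 q).symm]; simp

/-- The coefficient of `x₂x₃^{q−1}` in `F_ε` is `ε`. -/
theorem coeff_e2_F (q : ℕ) (ε : K) : coeff (e2 q) (F q ε) = ε := by
  rw [coeff_F, if_neg (e1_ne_e2 q), if_pos rfl, if_neg (e2_ne_e3 q).symm]; simp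

/-- `F_ε ≠ 0`. -/
theorem F_ne_zero (q : ℕ) (ε : K) : F q ε ≠ 0 := fun h => by
  have := coeff_e1_F q ε; rw [h, coeff_zero] at this; exact zero_ne_one this

/-- The support of `F_ε` lies in its three exponents. -/
theorem support_F_subset (q : ℕ) (ε : K) : (F q ε).support ⊆ {e1 q, e2 q, e3 q} := by
  intro d hd
  simp only [Finset.mem_insert, Finset.mem_singleton]
  unfold F at hd
  rcases Finset.mem_union.mp (support_add hd) with h | h
  · rcases Finset.mem_union.mp (support_add h) with h | h
    · exact Or.inl (Finset.mem_singleton.mp (support_monomial_subset h))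
    · exact Or.inr (Or.inl (Finset.mem_singleton.mp (support_monomial_subset h)))
  · exact Or.inr (Or.inr (Finset.mem_singleton.mp (support_monomial_subset h)))

/-- Degree in the variables `{x₂,x₃,x₄}`. -/
theorem degIn_T123 (d : Fin 4 →₀ ℕ) : degIn T123 d = d 1 + d 2 + d 3 :=
  degIn_triple (by decide) (by decide) (by decide) d

/-- For a centre containing `{x₂,x₃,x₄}` and an exponent with no `x₁`, the `S`-degree is `d₁ + d₂ + d₃`. -/
theorem degIn_eq_of_subset {S : Finset (Fin 4)} (hS : T123 ⊆ S) {d : Fin 4 →₀ ℕ} (hd : d 0 = 0) :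
    degIn S d = d 1 + d 2 + d 3 := by
  apply le_antisymm
  · have := degIn_mono (Finset.subset_univ S) d
    rw [Trap1.degIn_univ4, hd, zero_add] at this; exact this
  · have := degIn_mono hS d
    rwa [degIn_T123] at this

/-- `S`-degree of `e1` is `q` (for `S ⊇ {x₂,x₃,x₄}`, `q ≥ 1`). -/
theorem degIn_e1 {S : Finset (Fin 4)} (hS : T123 ⊆ S) {q : ℕ} (hq : 1 ≤ q) : degIn S (e1 q) = q := by
  rw [degIn_eq_of_subset hS (by simp)]; simp; omega
/-- `S`-degree of `e2` is `q`. -/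
theorem degIn_e2 {S : Finset (Fin 4)} (hS : T123 ⊆ S) {q : ℕ} (hq : 1 ≤ q) : degIn S (e2 q) = q := by
  rw [degIn_eq_of_subset hS (by simp)]; simp; omega
/-- `S`-degree of `e3` is `q + 1`. -/
theorem degIn_e3 {S : Finset (Fin 4)} (hS : T123 ⊆ S) {q : ℕ} (hq : 1 ≤ q) : degIn S (e3 q) = q + 1 := by
  rw [degIn_eq_of_subset hS (by simp)]; simp; omega

/-- `ord_{(x_S)} F_ε = q` for every `S ⊇ {x₂,x₃,x₄}`. [folklore] -/
theorem ordAlong_F {S : Finset (Fin 4)} (hS : T123 ⊆ S) {q : ℕ} (hq : 1 ≤ q) (ε : K) :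
    ordAlong S (F q ε) = q := by
  apply le_antisymm
  · have := ordAlong_le_of_coeff_ne_zero (S := S) (d := e1 q) (F := F q ε) (by rw [coeff_e1_F]; exact one_ne_zero)
    rwa [degIn_e1 hS hq] at this
  · apply le_ordAlong_of_forall
    intro d hd
    have hd' := support_F_subset q ε hd
    simp only [Finset.mem_insert, Finset.mem_singleton] at hd'
    rcases hd' with rfl | rfl | rfl
    · rw [degIn_e1 hS hq]
    · rw [degIn_e2 hS hq]
    · rw [degIn_e3 hS hq]; omega

/-- `ord₀ F_ε = q`. [folklore] -/
theorem ordZero_F {q : ℕ} (hq : 1 ≤ q) (ε : K) : ordZero (F q ε) = q := by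
  rw [← ordAlong_univ]; exact ordAlong_F (Finset.subset_univ _) hq ε

/-- No monomial of degree `< q` in `F_ε`. [folklore] -/
theorem coeff_F_of_degree_lt {q : ℕ} (hq : 1 ≤ q) (ε : K) {d : Fin 4 →₀ ℕ} (hd : d.degree < q) :
    coeff d (F q ε) = 0 := by
  rw [← degIn_univ] at hd
  by_contra hne
  have h1 := ordAlong_le_of_coeff_ne_zero (S := Finset.univ) hne
  rw [ordAlong_F (Finset.subset_univ _) hq ε] at h1
  exact absurd (by exact_mod_cast h1) (not_le.mpr hd)

/-! ## the permissible coordinate centres are exactly the line `V(z,x₂,x₃,x₄)` and the point -/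

/-- A Hironaka-permissible coordinate centre for `z^q + F_ε` (`ε ≠ 0`, `q ≥ 2`) contains `{x₂,x₃,x₄}`. -/
theorem subset_of_isPermissibleCentre {q : ℕ} (hq : 2 ≤ q) {ε : K} (hε : ε ≠ 0) {S : Finset (Fin 4)}
    (h : IsPermissibleCentre q S (F q ε)) : T123 ⊆ S := by
  have h1 : (q : ℕ∞) ≤ degIn S (e1 q) :=
    le_trans h.2 (ordAlong_le_of_coeff_ne_zero (by rw [coeff_e1_F]; exact one_ne_zero))
  have h2 : (q : ℕ∞) ≤ degIn S (e2 q) :=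
    le_trans h.2 (ordAlong_le_of_coeff_ne_zero (by rw [coeff_e2_F]; exact hε))
  have h1' : q ≤ degIn S (e1 q) := by exact_mod_cast h1
  have h2' : q ≤ degIn S (e2 q) := by exact_mod_cast h2
  intro i hi
  simp only [T123, Finset.mem_insert, Finset.mem_singleton] at hi
  by_contra hiS
  have hsub : S ⊆ Finset.univ.erase i := fun k hk =>
    Finset.mem_erase.mpr ⟨fun hki => hiS (hki ▸ hk), Finset.mem_univ k⟩
  rcases hi with rfl | rfl | rfl
  · have := le_trans h2' (degIn_mono hsub (e2 q))
    rw [show (Finset.univ : Finset (Fin 4)).erase 1 = {0, 2, 3} by decide,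
      degIn_triple (by decide) (by decide) (by decide)] at this
    simp at this; omega
  · have := le_trans h1' (degIn_mono hsub (e1 q))
    rw [show (Finset.univ : Finset (Fin 4)).erase 2 = {0, 1, 3} by decide,
      degIn_triple (by decide) (by decide) (by decide)] at this
    simp at this; omega
  · have := le_trans h1' (degIn_mono hsub (e1 q))
    rw [show (Finset.univ : Finset (Fin 4)).erase 3 = {0, 1, 2} by decide,
      degIn_triple (by decide) (by decide) (by decide)] at this
    simp at this; omega

/-- Every centre containing `{x₂,x₃,x₄}` IS permissible (`q ≥ 1`). -/
theorem isPermissibleCentre_of_subset {q : ℕ} (hq : 1 ≤ q) (ε : K) {S : Finset (Fin 4)} (hS : T123 ⊆ S) :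
    IsPermissibleCentre q S (F q ε) :=
  ⟨⟨1, hS (by simp [T123])⟩, by rw [ordAlong_F hS hq ε]⟩

/-- **The permissible coordinate centres are exactly those containing `{x₂,x₃,x₄}`** — the line and
the point. [folklore] -/
theorem isPermissibleCentre_iff_subset {q : ℕ} (hq : 2 ≤ q) {ε : K} (hε : ε ≠ 0) (S : Finset (Fin 4)) :
    IsPermissibleCentre q S (F q ε) ↔ T123 ⊆ S :=
  ⟨subset_of_isPermissibleCentre hq hε, isPermissibleCentre_of_subset (by omega) ε⟩

/-- The two such centres. -/
theorem eq_of_subset {S : Finset (Fin 4)} (hS : T123 ⊆ S) : S = T123 ∨ S = Finset.univ := by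
  revert hS; revert S; decide

/-- The line `V(z,x₂,x₃,x₄)` is a MODE-1h centre (least cardinality). [folklore] -/
theorem isMode1hCentre_T123 {q : ℕ} (hq : 2 ≤ q) {ε : K} (hε : ε ≠ 0) : IsMode1hCentre q T123 (F q ε) :=
  ⟨isPermissibleCentre_of_subset (by omega) ε subset_rfl,
    fun _ hS' => Finset.card_le_card (subset_of_isPermissibleCentre hq hε hS')⟩

/-- Condition (2) holds for every centre containing the line (`r = 0`, shade `= q = ord`). [folklore] -/
theorem perm2_of_subset {q : ℕ} (hq : 1 ≤ q) (ε : K) {S : Finset (Fin 4)} (hS : T123 ⊆ S) :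
    Perm2 S (st q ε) := by
  unfold Perm2 CState.shade
  rw [show (st q ε).r = 0 from rfl, show (st q ε).F = F q ε from rfl, degIn_zero, ordAlong_F hS hq,
    ordZero_F hq, map_zero]
  simp

/-- The line is an m1 centre (conditions (1) ∧ (2), least cardinality among such). [folklore] -/
theorem isModeM1Centre_T123 {q : ℕ} (hq : 2 ≤ q) {ε : K} (hε : ε ≠ 0) : IsModeM1Centre q T123 (st q ε) :=
  ⟨isPermissibleCentre_of_subset (by omega) ε subset_rfl, perm2_of_subset (by omega) ε subset_rfl,
    fun _ hS' _ => Finset.card_le_card (subset_of_isPermissibleCentre hq hε hS')⟩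

/-- The line is a 1h2 centre. [folklore] -/
theorem isMode1h2Centre_T123 {q : ℕ} (hq : 2 ≤ q) {ε : K} (hε : ε ≠ 0) : IsMode1h2Centre q T123 (st q ε) :=
  ⟨isPermissibleCentre_of_subset (by omega) ε subset_rfl, fun _ => perm2_of_subset (by omega) ε subset_rfl,
    fun _ hS' _ => Finset.card_le_card (subset_of_isPermissibleCentre hq hε hS')⟩

/-! ## the `x₂`-chart: transform, translation, cleaning -/

/-- `x₂`-chart exponent of `e1` (unchanged). -/
theorem chartExponent_e1 {S : Finset (Fin 4)} (hS : T123 ⊆ S) {q : ℕ} (hq : 1 ≤ q) :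
    chartExponent q S 1 (e1 q) = e1 q := by
  rw [chartExponent_eq_iff, degIn_e1 hS hq]; refine ⟨by simp, fun i _ => rfl⟩
/-- `x₂`-chart exponent of `e2` (becomes `e0`). -/
theorem chartExponent_e2 {S : Finset (Fin 4)} (hS : T123 ⊆ S) {q : ℕ} (hq : 1 ≤ q) :
    chartExponent q S 1 (e2 q) = e0 q := by
  rw [chartExponent_eq_iff, degIn_e2 hS hq]; refine ⟨by simp, fun i hi => ?_⟩; fin_cases i <;> simp_all
/-- `x₂`-chart exponent of `e3` (unchanged). -/
theorem chartExponent_e3 {S : Finset (Fin 4)} (hS : T123 ⊆ S) {q : ℕ} (hq : 1 ≤ q) :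
    chartExponent q S 1 (e3 q) = e3 q := by
  rw [chartExponent_eq_iff, degIn_e3 hS hq]; refine ⟨by simp, fun i _ => rfl⟩

/-- The `x₂`-chart transform of `F_ε` along any centre `⊇ {x₂,x₃,x₄}` is `G_ε`. [folklore] -/
theorem chartTransform_F {S : Finset (Fin 4)} (hS : T123 ⊆ S) {q : ℕ} (hq : 1 ≤ q) (ε : K) :
    chartTransform q S 1 (F q ε) = G q ε := by
  rw [F, chartTransform_add, chartTransform_add, chartTransform_monomial, chartTransform_monomial,
    chartTransform_monomial, chartExponent_e1 hS hq, chartExponent_e2 hS hq, chartExponent_e3 hS hq, G]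

/-- `e1` as a sum of singles. -/
theorem single_e1 (q : ℕ) : Finsupp.single (2 : Fin 4) (q - 1) + Finsupp.single 3 1 = e1 q := by
  ext i; fin_cases i <;> simp
/-- `e2` as a sum of singles. -/
theorem single_e2 (q : ℕ) : Finsupp.single (1 : Fin 4) 1 + Finsupp.single 2 (q - 1) = e2 q := by
  ext i; fin_cases i <;> simp
/-- `e3` as a sum of singles. -/
theorem single_e3 (q : ℕ) :
    Finsupp.single (1 : Fin 4) 1 + Finsupp.single 2 (q - 1) + Finsupp.single 3 1 = e3 q := by
  ext i; fin_cases i <;> simp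
/-- `e0` as a single. -/
theorem single_e0 (q : ℕ) : Finsupp.single (2 : Fin 4) (q - 1) = e0 q := by
  ext i; fin_cases i <;> simp

/-- `x₃^{q−1}x₄` as a monomial. -/
theorem monomial_e1 (q : ℕ) : (X 2 ^ (q - 1) * X 3 : MvPolynomial (Fin 4) K) = monomial (e1 q) 1 := by
  rw [X_pow_eq_monomial, X, monomial_mul, one_mul, single_e1]
/-- `ε·x₂x₃^{q−1}` as a monomial. -/
theorem monomial_e2 (q : ℕ) (ε : K) :
    (C ε * (X 1 * X 2 ^ (q - 1)) : MvPolynomial (Fin 4) K) = monomial (e2 q) ε := by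
  rw [X_pow_eq_monomial, X, monomial_mul, one_mul, C_mul_monomial, mul_one, single_e2]
/-- `x₂x₃^{q−1}x₄` as a monomial. -/
theorem monomial_e3 (q : ℕ) : (X 1 * X 2 ^ (q - 1) * X 3 : MvPolynomial (Fin 4) K) = monomial (e3 q) 1 := by
  rw [X_pow_eq_monomial, X, X, monomial_mul, monomial_mul, one_mul, one_mul, single_e3]
/-- `ε·x₃^{q−1}` as a monomial. -/
theorem monomial_e0 (q : ℕ) (ε : K) : (C ε * X 2 ^ (q - 1) : MvPolynomial (Fin 4) K) = monomial (e0 q) ε := by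
  rw [X_pow_eq_monomial, C_mul_monomial, mul_one, single_e0]

/-- `F_ε` written with variables. -/
theorem F_eq_X (q : ℕ) (ε : K) :
    F q ε = X 2 ^ (q - 1) * X 3 + C ε * (X 1 * X 2 ^ (q - 1)) + X 1 * X 2 ^ (q - 1) * X 3 := by
  rw [F, ← monomial_e1, ← monomial_e2, ← monomial_e3]
/-- `G_ε` written with variables. -/
theorem G_eq_X (q : ℕ) (ε : K) :
    G q ε = X 2 ^ (q - 1) * X 3 + C ε * X 2 ^ (q - 1) + X 1 * X 2 ^ (q - 1) * X 3 := by
  rw [G, ← monomial_e1, ← monomial_e0, ← monomial_e3]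

/-- **Translating `G_ε` by `x₄ ↦ x₄ − ε` gives `F_{−ε}`** (the constants cancel). [folklore] -/
theorem translate_G (q : ℕ) (ε : K) : PointBlowup.translate (bv ε) (G q ε) = F q (-ε) := by
  rw [G_eq_X, F_eq_X]
  simp only [PointBlowup.translate, map_add, map_mul, map_pow, MvPolynomial.aeval_X, MvPolynomial.aeval_C,
    MvPolynomial.algebraMap_eq, bv_one, bv_two, bv_three, map_zero, add_zero, map_neg]
  ring

/-- An exponent with an entry `1` is not a `q`-th power exponent for `q ≥ 2`. -/
private theorem not_pth_of_one {q : ℕ} (hq : 2 ≤ q) {d : Fin 4 →₀ ℕ} (i : Fin 4) (h : d i = 1) :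
    ¬ IsPthPowerExponent q d := fun hd => by
  have := Nat.le_of_dvd (by omega) (h ▸ (isPthPowerExponent_iff q d).mp hd i); omega

/-- `F_ε` is clean. [folklore] -/
theorem deletePthPowers_F {q : ℕ} (hq : 2 ≤ q) (ε : K) : deletePthPowers q (F q ε) = F q ε := by
  rw [F, deletePthPowers_add, deletePthPowers_add, deletePthPowers_monomial, deletePthPowers_monomial,
    deletePthPowers_monomial, if_neg (not_pth_of_one hq 3 (by simp)), if_neg (not_pth_of_one hq 1 (by simp)),
    if_neg (not_pth_of_one hq 1 (by simp))]

/-! ## the step -/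


/-- The transform of `s_ε` at the point `x₄ ↦ x₄ − ε` of the `x₂`-chart is `F_{−ε}`. -/
theorem pointTransform_st {S : Finset (Fin 4)} (hS : T123 ⊆ S) {q : ℕ} (hq : 1 ≤ q) (ε : K) :
    pointTransform q S 1 (bv ε) (st q ε) = F q (-ε) := by
  rw [pointTransform, show (st q ε).F = F q ε from rfl, chartTransform_F hS hq, translate_G]

/-- That point is equimultiple. -/
theorem isEquimultiplePoint_st {S : Finset (Fin 4)} (hS : T123 ⊆ S) {q : ℕ} (hq : 1 ≤ q) (ε : K) :
    IsEquimultiplePoint q S 1 (bv ε) (st q ε) := by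
  intro d _ hdeg; rw [pointTransform_st hS hq]; exact coeff_F_of_degree_lt hq (-ε) hdeg

variable [DecidableEq K]

/-- **The step** along any centre `⊇ {x₂,x₃,x₄}`, `x₂`-chart, point `x₄ ↦ x₄ − ε`, maps `s_ε` to `s_{−ε}`
LITERALLY. [folklore] -/
theorem step_st {S : Finset (Fin 4)} (hS : T123 ⊆ S) {q : ℕ} (hq : 2 ≤ q) (ε : K) :
    CentreBlowup.step q S 1 (bv ε) (st q ε) = st q (-ε) := by
  have hF : deletePthPowers q (pointTransform q S 1 (bv ε) (st q ε)) = F q (-ε) := by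
    rw [pointTransform_st hS (by omega), deletePthPowers_F hq]
  have hr : newMult q S 1 (bv ε) (st q ε) = 0 := by
    unfold newMult
    rw [show (st q ε).r = 0 from rfl, Finsupp.filter_zero, show (st q ε).F = F q ε from rfl,
      ordAlong_F hS (by omega) ε, ENat.toNat_coe, Nat.sub_self]
    ext i; rw [Finsupp.update_apply]; split_ifs <;> rfl
  have he : newExc 1 (bv ε) (st q ε) = ({1} : Finset (Fin 4)) := by
    unfold newExc
    rw [show (st q ε).exc = ({1} : Finset (Fin 4)) from rfl, Finset.filter_singleton, if_pos (bv_one ε),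
      Finset.insert_eq_of_mem (Finset.mem_singleton_self 1)]
  unfold CentreBlowup.step
  rw [hF, hr, he]; rfl

/-- The edge `s_ε ⟶ s_{−ε}` along any centre `⊇ {x₂,x₃,x₄}`. [folklore] -/
theorem edge_st {S : Finset (Fin 4)} (hS : T123 ⊆ S) {q : ℕ} (hq : 2 ≤ q) (ε : K) :
    Edge q S (st q ε) (st q (-ε)) :=
  ⟨1, bv ε, hS (by simp [T123]), bv_one ε, isEquimultiplePoint_st hS (by omega) ε,
    by rw [step_st hS hq]; exact F_ne_zero q (-ε), (step_st hS hq ε).symm⟩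

end UniformTrap

end

end Summit.ResolutionOfSingularities.ResolutionOfSingularities.Theorems.PIDim4
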